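import Literature.Probability.RandomPlanarGeometry.SAWBridges
import Literature.Probability.RandomPlanarGeometry.SAWBridgeRadius

/-!
# Strip bridges at `x_c`: concatenation and supermultiplicativity of the confined mass

Support file for crux item `stmt-CriticalPhenomena-4728` (`SAWRenewalTightness.ShellCrossingBound`),
line `kesten-defect-renewal`, stub `stub_tubeMass_of_stripDecay` (S3, amplitude removal
`A · W · e^{-cL/W} ⟹ A' · e^{-cL/W}` for the critical mass of bridges confined to a strip).

Vocabulary (vertex-function model of `SAWCount.lean` / `SAWBridges.lean` on `ℤ²`, heights =
coordinate `1`, spans = coordinate `0`). A *strip bridge of width `W`, span `L`, from height `y`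
to height `y'`, with `n` steps* is an `ω ∈ SAW.Zd.bridges 2 n` with `ω n 0 = L`,
`y + ω n 1 = y'` and `0 ≤ y + ω i 1 < W` for all `i ≤ n`; the finite set of them is written
throughout as the explicit `Finset.filter` of the line skeleton (no new definition), and the
partial sums `P(N; W, y, y', L) = Σ_{n ≤ N} Σ_ω x_c^n` of their critical mass likewise.

## Contents (namespace `Summit.CriticalPhenomena.SAWScalingLimit.Theorems`, helpers in `….TubeMass`; all proved)

* `concatWalk_apply_of_le`, `concatWalk_apply_add` — values of `SAW.Zd.concatWalk`;
* `apply_zero_le_of_mem_bridges`, `apply_zero_pos_of_mem_bridges` — the first coordinate of a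
  bridge lies in `(0, ω n 0]` after time `0`;
* `concatWalk_mem_bridges` — the concatenation of two bridges is a bridge (Madras–Slade (1.2.15),
  the membership half of `SAW.Zd.bridgeCount_mul_le`);
* `concatWalk_mem_filter` — the concatenation of a strip bridge `y → y'` of span `L` with a strip
  bridge `y' → y''` of span `M` is a strip bridge `y → y''` of span `L + M` (same width);
* `not_lt_of_concatWalk_eq`, `concatWalk_inj` — the concatenation is injective on pairs (the cut
  time is the last time with first coordinate `≤ L`);
* `stripBridgeMass_mul_le` — **supermultiplicativity of the confined critical mass**:
  `P(N₁; W, y, y', L) · P(N₂; W, y', y'', M) ≤ P(N; W, y, y'', L + M)` for `M ≥ 1`, `N₁ + N₂ ≤ N`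
  (Madras–Slade (1.2.15) run inside the strip, with weights `x_c^n`).

References: N. Madras, G. Slade, *The Self-Avoiding Walk* (1993), §1.2 eq. (1.2.15), §4.1
(Lemma 4.1.11, Lemma 4.1.12), §8.2.
-/

open Finset Literature.Probability.LatticeModels Literature.Probability.RandomPlanarGeometry
open Literature.Probability.RandomPlanarGeometry.SAW.Zd
open scoped BigOperators Classical

namespace Summit.CriticalPhenomena.SAWScalingLimit.Theorems

namespace TubeMass

/-! ### Values of `concatWalk`; first-coordinate bounds for bridges -/

/-- Before the cut time the concatenation is the first walk. [folklore] -/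
theorem concatWalk_apply_of_le {m : ℕ} (ω υ : ℕ → Site 2) {i : ℕ} (hi : i ≤ m) :
    concatWalk m ω υ i = ω i := by
  simp only [concatWalk, if_pos hi]

/-- After the cut time the concatenation is the translated second walk (for a second walk
starting at `0`, including the cut time itself). [folklore] -/
theorem concatWalk_apply_add {m : ℕ} (ω υ : ℕ → Site 2) (h0 : υ 0 = 0) (j : ℕ) :
    concatWalk m ω υ (m + j) = ω m + υ j := by
  rcases Nat.eq_zero_or_pos j with rfl | hj
  · simp only [concatWalk, add_zero, if_pos le_rfl, h0]
  · simp only [concatWalk, if_neg (by omega : ¬ m + j ≤ m), Nat.add_sub_cancel_left]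

/-- The first coordinate of a bridge from the origin is at most its final value.
[cite: MadrasSlade1993, Definition 1.2.4] -/
theorem apply_zero_le_of_mem_bridges {n : ℕ} {ω : ℕ → Site 2} (h : ω ∈ bridges 2 n) {i : ℕ}
    (hi : i ≤ n) : ω i 0 ≤ ω n 0 := by
  obtain ⟨hs, hb⟩ := mem_bridges.1 h
  have h0 : ω 0 = 0 := (mem_saws.1 hs).1
  rcases Nat.eq_zero_or_pos i with rfl | hpos
  · rcases Nat.eq_zero_or_pos n with rfl | hn
    · exact le_rfl
    · have := (hb n hn le_rfl).1
      exact this.le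
  · exact (hb i hpos hi).2

/-- The first coordinate of a bridge from the origin is positive after time `0`.
[cite: MadrasSlade1993, Definition 1.2.4] -/
theorem apply_zero_pos_of_mem_bridges {n : ℕ} {ω : ℕ → Site 2} (h : ω ∈ bridges 2 n) {i : ℕ}
    (h1 : 1 ≤ i) (hi : i ≤ n) : 0 < ω i 0 := by
  obtain ⟨hs, hb⟩ := mem_bridges.1 h
  have h0 : ω 0 = 0 := (mem_saws.1 hs).1
  have := (hb i h1 hi).1
  rwa [h0] at this

/-- A bridge from the origin with positive span has at least one step. [folklore] -/
theorem one_le_of_mem_bridges {n : ℕ} {ω : ℕ → Site 2} (h : ω ∈ bridges 2 n) {M : ℕ}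
    (hM : 1 ≤ M) (hend : ω n 0 = (M : ℤ)) : 1 ≤ n := by
  rcases Nat.eq_zero_or_pos n with rfl | hn
  · have h0 : ω 0 = 0 := (mem_saws.1 (mem_bridges.1 h).1).1
    rw [h0] at hend
    simp only [Pi.zero_apply] at hend
    omega
  · exact hn

/-! ### Concatenation of bridges and of strip bridges -/

/-- **The concatenation of two bridges is a bridge** ("the concatenation of two bridges will
always yield another bridge"): the second piece lives in the slab beyond the span of the first.
[cite: MadrasSlade1993, §1.2, eq. (1.2.15)] -/
theorem concatWalk_mem_bridges {m n : ℕ} {ω υ : ℕ → Site 2} (hω : ω ∈ bridges 2 m)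
    (hυ : υ ∈ bridges 2 n) : concatWalk m ω υ ∈ bridges 2 (m + n) := by
  have hωb := (mem_bridges.1 hω).2
  have hυb := (mem_bridges.1 hυ).2
  have hω0 : ω 0 = 0 := (mem_saws.1 (mem_bridges.1 hω).1).1
  have hυ0 : υ 0 = 0 := (mem_saws.1 (mem_bridges.1 hυ).1).1
  have h00 : (0 : Site 2) 0 = 0 := rfl
  have hle : ∀ i ≤ m, ω i 0 ≤ ω m 0 := fun i hi => apply_zero_le_of_mem_bridges hω hi
  have hυn : 0 ≤ υ n 0 := by
    have := apply_zero_le_of_mem_bridges hυ (Nat.zero_le n)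
    rwa [hυ0] at this
  have hgt : ∀ j, 1 ≤ j → j ≤ n → ω m 0 < (ω m + υ j) 0 := by
    intro j h1 h2
    have := apply_zero_pos_of_mem_bridges hυ h1 h2
    simp only [Pi.add_apply]
    linarith
  refine mem_bridges.2 ⟨concatWalk_mem_saws (mem_bridges.1 hω).1 (mem_bridges.1 hυ).1
    fun i hi j h1 h2 heq => ?_, ?_⟩
  · have ha := hle i hi
    have hb := hgt j h1 h2
    rw [← heq] at hb
    linarith
  · intro i h1 h2
    have hstart : concatWalk m ω υ 0 = 0 := by
      rw [concatWalk_apply_of_le ω υ (Nat.zero_le m), hω0]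
    have hlast : concatWalk m ω υ (m + n) 0 = ω m 0 + υ n 0 := by
      rw [concatWalk_apply_add ω υ hυ0 n, Pi.add_apply]
    rw [hstart, hlast, h00]
    by_cases h : i ≤ m
    · rw [concatWalk_apply_of_le ω υ h]
      have := (hωb i h1 h).1
      rw [hω0, h00] at this
      exact ⟨this, (hle i h).trans (by linarith [hυn])⟩
    · obtain ⟨j, rfl⟩ : ∃ j, i = m + j := ⟨i - m, by omega⟩
      rw [concatWalk_apply_add ω υ hυ0 j, Pi.add_apply]
      have := hυb j (by omega) (by omega)
      rw [hυ0, h00] at this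
      have hm0 : 0 ≤ ω m 0 := by have := hle 0 (Nat.zero_le m); rwa [hω0] at this
      exact ⟨by linarith [this.1], by linarith [this.2]⟩

/-- **Concatenation of strip bridges.** A strip bridge of width `W` and span `L` from height `y`
to height `y'`, followed by (the translate of) a strip bridge of width `W` and span `M` from
height `y'` to height `y''`, is a strip bridge of width `W` and span `L + M` from height `y` to
height `y''`. [cite: MadrasSlade1993, §1.2, eq. (1.2.15)] -/
theorem concatWalk_mem_filter {W : ℕ} {y y' y'' : ℤ} {L M n₁ n₂ : ℕ} {ω₁ ω₂ : ℕ → Site 2}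
    (h₁ : ω₁ ∈ (SAW.Zd.bridges 2 n₁).filter (fun ω =>
      ω n₁ 0 = (L : ℤ) ∧ y + ω n₁ 1 = y' ∧ ∀ i ≤ n₁, 0 ≤ y + ω i 1 ∧ y + ω i 1 < W))
    (h₂ : ω₂ ∈ (SAW.Zd.bridges 2 n₂).filter (fun ω =>
      ω n₂ 0 = (M : ℤ) ∧ y' + ω n₂ 1 = y'' ∧ ∀ i ≤ n₂, 0 ≤ y' + ω i 1 ∧ y' + ω i 1 < W)) :
    concatWalk n₁ ω₁ ω₂ ∈ (SAW.Zd.bridges 2 (n₁ + n₂)).filter (fun ω =>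
      ω (n₁ + n₂) 0 = ((L + M : ℕ) : ℤ) ∧ y + ω (n₁ + n₂) 1 = y'' ∧
        ∀ i ≤ n₁ + n₂, 0 ≤ y + ω i 1 ∧ y + ω i 1 < W) := by
  rw [Finset.mem_filter] at h₁ h₂ ⊢
  obtain ⟨hb₁, hL, hy₁, hs₁⟩ := h₁
  obtain ⟨hb₂, hM, hy₂, hs₂⟩ := h₂
  have h0₂ : ω₂ 0 = 0 := (mem_saws.1 (mem_bridges.1 hb₂).1).1
  refine ⟨concatWalk_mem_bridges hb₁ hb₂, ?_, ?_, ?_⟩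
  · rw [concatWalk_apply_add ω₁ ω₂ h0₂ n₂, Pi.add_apply, hL, hM, Nat.cast_add]
  · rw [concatWalk_apply_add ω₁ ω₂ h0₂ n₂, Pi.add_apply, ← add_assoc, hy₁, hy₂]
  · intro i hi
    rcases le_or_gt i n₁ with h | h
    · rw [concatWalk_apply_of_le ω₁ ω₂ h]
      exact hs₁ i h
    · obtain ⟨j, rfl⟩ : ∃ j, i = n₁ + j := ⟨i - n₁, by omega⟩
      rw [concatWalk_apply_add ω₁ ω₂ h0₂ j, Pi.add_apply, ← add_assoc, hy₁]
      exact hs₂ j (by omega)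

/-! ### Injectivity of the concatenation -/

/-- If two concatenations of (bridge of span `L`, bridge with at least one step) agree, the
first cut time is not smaller than the second: one step after the smaller cut time the first
walk has first coordinate `> L`, the second `≤ L`. [cite: MadrasSlade1993, §1.2, eq. (1.2.15)] -/
theorem not_lt_of_concatWalk_eq {L : ℤ} {n₁ n₂ n₁' : ℕ} {ω₁ ω₂ ω₁' ω₂' : ℕ → Site 2}
    (hL : ω₁ n₁ 0 = L) (hb₂ : ω₂ ∈ bridges 2 n₂) (hn₂ : 1 ≤ n₂)
    (hb₁' : ω₁' ∈ bridges 2 n₁') (hL' : ω₁' n₁' 0 = L)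
    (heq : concatWalk n₁ ω₁ ω₂ = concatWalk n₁' ω₁' ω₂') : ¬ n₁ < n₁' := by
  intro hlt
  have h0₂ : ω₂ 0 = 0 := (mem_saws.1 (mem_bridges.1 hb₂).1).1
  have e := congrFun (congrFun heq (n₁ + 1)) 0
  rw [concatWalk_apply_add ω₁ ω₂ h0₂ 1, concatWalk_apply_of_le ω₁' ω₂' (by omega : n₁ + 1 ≤ n₁'),
    Pi.add_apply, hL] at e
  have h1 := apply_zero_pos_of_mem_bridges hb₂ le_rfl hn₂
  have h2 := apply_zero_le_of_mem_bridges hb₁' (by omega : n₁ + 1 ≤ n₁')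
  rw [hL'] at h2
  linarith

/-- **The concatenation is injective** on pairs (bridge of span `L`, bridge with at least one
step): the cut time, hence both pieces, are recovered from the concatenation.
[cite: MadrasSlade1993, §1.2, eq. (1.2.15)] -/
theorem concatWalk_inj {L : ℤ} {n₁ n₂ n₁' n₂' : ℕ} {ω₁ ω₂ ω₁' ω₂' : ℕ → Site 2}
    (hb₁ : ω₁ ∈ bridges 2 n₁) (hL : ω₁ n₁ 0 = L) (hb₂ : ω₂ ∈ bridges 2 n₂) (hn₂ : 1 ≤ n₂)
    (hb₁' : ω₁' ∈ bridges 2 n₁') (hL' : ω₁' n₁' 0 = L) (hb₂' : ω₂' ∈ bridges 2 n₂')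
    (hn₂' : 1 ≤ n₂') (hn : n₁ + n₂ = n₁' + n₂')
    (heq : concatWalk n₁ ω₁ ω₂ = concatWalk n₁' ω₁' ω₂') :
    n₁ = n₁' ∧ ω₁ = ω₁' ∧ n₂ = n₂' ∧ ω₂ = ω₂' := by
  have hn₁ : n₁ = n₁' :=
    le_antisymm (not_lt.1 (not_lt_of_concatWalk_eq hL' hb₂' hn₂' hb₁ hL heq.symm))
      (not_lt.1 (not_lt_of_concatWalk_eq hL hb₂ hn₂ hb₁' hL' heq))
  subst hn₁
  have h0₂ : ω₂ 0 = 0 := (mem_saws.1 (mem_bridges.1 hb₂).1).1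
  have h0₂' : ω₂' 0 = 0 := (mem_saws.1 (mem_bridges.1 hb₂').1).1
  have hω₁ : ω₁ = ω₁' := by
    have hle : ∀ i ≤ n₁, ω₁ i = ω₁' i := fun i hi => by
      have e := congrFun heq i
      rwa [concatWalk_apply_of_le ω₁ ω₂ hi, concatWalk_apply_of_le ω₁' ω₂' hi] at e
    funext i
    rcases le_or_gt i n₁ with hi | hi
    · exact hle i hi
    · rw [(mem_saws.1 (mem_bridges.1 hb₁).1).2.1 i hi.le,
        (mem_saws.1 (mem_bridges.1 hb₁').1).2.1 i hi.le, hle n₁ le_rfl]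
  subst hω₁
  refine ⟨rfl, rfl, by omega, funext fun j => ?_⟩
  have e := congrFun heq (n₁ + j)
  rwa [concatWalk_apply_add ω₁ ω₂ h0₂ j, concatWalk_apply_add ω₁ ω₂' h0₂' j, add_right_inj] at e

end TubeMass

/-! ### Supermultiplicativity of the confined critical mass -/

open TubeMass in
/-- **Supermultiplicativity of the critical mass of strip bridges** (Madras–Slade (1.2.15) inside
the strip, weighted by `x_c^n`): for spans `L` and `M ≥ 1` with `L + M = K` and `N₁ + N₂ ≤ N`,
`P(N₁; W, y, y', L) · P(N₂; W, y', y'', M) ≤ P(N; W, y, y'', K)`, where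
`P(N; W, y, y', L) = Σ_{n ≤ N} Σ_{ω} x_c^n` sums over the `n`-step strip bridges of width `W` and
span `L` from height `y` to height `y'`. Proof: expand the product as a sum over pairs and inject
the pairs by concatenation (`concatWalk_mem_filter`, `concatWalk_inj`).
[cite: MadrasSlade1993, §1.2, eq. (1.2.15)] -/
theorem stripBridgeMass_mul_le :
    ∀ (W : ℕ) (y y' y'' : ℤ) (L M K : ℕ), 1 ≤ M → L + M = K → ∀ (N₁ N₂ N : ℕ), N₁ + N₂ ≤ N →
      (∑ n ∈ Finset.range (N₁ + 1),
        ∑ _ω ∈ (SAW.Zd.bridges 2 n).filter (fun ω =>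
            ω n 0 = (L : ℤ) ∧ y + ω n 1 = y' ∧ ∀ i ≤ n, 0 ≤ y + ω i 1 ∧ y + ω i 1 < W),
          SAW.criticalFugacity ^ n) *
      (∑ n ∈ Finset.range (N₂ + 1),
        ∑ _ω ∈ (SAW.Zd.bridges 2 n).filter (fun ω =>
            ω n 0 = (M : ℤ) ∧ y' + ω n 1 = y'' ∧ ∀ i ≤ n, 0 ≤ y' + ω i 1 ∧ y' + ω i 1 < W),
          SAW.criticalFugacity ^ n) ≤
      ∑ n ∈ Finset.range (N + 1),
        ∑ _ω ∈ (SAW.Zd.bridges 2 n).filter (fun ω =>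
            ω n 0 = (K : ℤ) ∧ y + ω n 1 = y'' ∧ ∀ i ≤ n, 0 ≤ y + ω i 1 ∧ y + ω i 1 < W),
          SAW.criticalFugacity ^ n := by
  intro W y y' y'' L M K hM hK N₁ N₂ N hN
  subst hK
  have hxc : 0 ≤ SAW.criticalFugacity := SAW.criticalFugacity_pos.le
  rw [Finset.sum_sigma', Finset.sum_sigma', Finset.sum_sigma', Finset.sum_mul_sum,
    ← Finset.sum_product']
  -- the pairs, the target, and the concatenation map
  set S₁ := (Finset.range (N₁ + 1)).sigma fun n => (SAW.Zd.bridges 2 n).filter (fun ω =>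
    ω n 0 = (L : ℤ) ∧ y + ω n 1 = y' ∧ ∀ i ≤ n, 0 ≤ y + ω i 1 ∧ y + ω i 1 < W) with hS₁
  set S₂ := (Finset.range (N₂ + 1)).sigma fun n => (SAW.Zd.bridges 2 n).filter (fun ω =>
    ω n 0 = (M : ℤ) ∧ y' + ω n 1 = y'' ∧ ∀ i ≤ n, 0 ≤ y' + ω i 1 ∧ y' + ω i 1 < W) with hS₂
  set T := (Finset.range (N + 1)).sigma fun n => (SAW.Zd.bridges 2 n).filter (fun ω =>
    ω n 0 = ((L + M : ℕ) : ℤ) ∧ y + ω n 1 = y'' ∧ ∀ i ≤ n, 0 ≤ y + ω i 1 ∧ y + ω i 1 < W)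
    with hT
  set Φ : (Σ _ : ℕ, (ℕ → Site 2)) × (Σ _ : ℕ, (ℕ → Site 2)) → (Σ _ : ℕ, (ℕ → Site 2)) :=
    fun r => ⟨r.1.1 + r.2.1, concatWalk r.1.1 r.1.2 r.2.2⟩ with hΦ
  have hinj : Set.InjOn Φ ↑(S₁ ×ˢ S₂) := by
    rintro ⟨⟨n₁, ω₁⟩, ⟨n₂, ω₂⟩⟩ hr ⟨⟨n₁', ω₁'⟩, ⟨n₂', ω₂'⟩⟩ hr' h
    rw [Finset.coe_product, Set.mem_prod, Finset.mem_coe, Finset.mem_coe, hS₁, hS₂,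
      Finset.mem_sigma, Finset.mem_sigma, Finset.mem_filter, Finset.mem_filter] at hr hr'
    simp only [hΦ, Sigma.mk.inj_iff, heq_eq_eq] at h
    obtain ⟨hn, hΩ⟩ := h
    obtain ⟨⟨-, hb₁, hL₁, -⟩, ⟨-, hb₂, hM₂, -⟩⟩ := hr
    obtain ⟨⟨-, hb₁', hL₁', -⟩, ⟨-, hb₂', hM₂', -⟩⟩ := hr'
    obtain ⟨rfl, rfl, rfl, rfl⟩ := concatWalk_inj hb₁ hL₁ hb₂ (one_le_of_mem_bridges hb₂ hM hM₂)
      hb₁' hL₁' hb₂' (one_le_of_mem_bridges hb₂' hM hM₂') hn hΩ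
    rfl
  have hsub : (S₁ ×ˢ S₂).image Φ ⊆ T := by
    intro t ht
    rw [Finset.mem_image] at ht
    obtain ⟨⟨⟨n₁, ω₁⟩, ⟨n₂, ω₂⟩⟩, hr, rfl⟩ := ht
    simp only [Finset.mem_product, hS₁, hS₂, Finset.mem_sigma, Finset.mem_range] at hr
    rw [hT, Finset.mem_sigma, Finset.mem_range]
    refine ⟨?_, concatWalk_mem_filter hr.1.2 hr.2.2⟩
    show n₁ + n₂ < N + 1
    omega
  calc ∑ r ∈ S₁ ×ˢ S₂, SAW.criticalFugacity ^ r.1.1 * SAW.criticalFugacity ^ r.2.1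
      = ∑ r ∈ S₁ ×ˢ S₂, (fun t : Σ _ : ℕ, (ℕ → Site 2) => SAW.criticalFugacity ^ t.1) (Φ r) :=
        Finset.sum_congr rfl fun r _ => by simp only [hΦ, pow_add]
    _ = ∑ t ∈ (S₁ ×ˢ S₂).image Φ, SAW.criticalFugacity ^ t.1 :=
        (Finset.sum_image (f := fun t : Σ _ : ℕ, (ℕ → Site 2) => SAW.criticalFugacity ^ t.1)
          hinj).symm
    _ ≤ ∑ t ∈ T, SAW.criticalFugacity ^ t.1 :=
        Finset.sum_le_sum_of_subset_of_nonneg hsub fun _ _ _ => pow_nonneg hxc _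

end Summit.CriticalPhenomena.SAWScalingLimit.Theorems
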